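import Summits.Ventures.Crystal3D.Theorems.StickyWulffConstantPolycrystalWulffBoundTwinColoniesChimera
import Summits.Ventures.Crystal3D.Theorems.StickyWulffConstantPolycrystalWulffBoundMinkowskiUpper
import Summits.Ventures.Crystal3D.Theorems.StickyWulffConstantPolycrystalWulffBoundSeparated

/-!
# `PolycrystalWulffBound`, line `PolyDensity`: the rung `rung_twinColonies` — a polyhedral grain with
# finitely many separated LAMELLAR TWIN COLONIES about different axes (localized parent clause) satisfies
# the polycrystal Wulff bound with the FREE energy alone (crux `stmt-Ventures-19482`)

Route `StickyWulffConstant` of the venture `Summits/Ventures/Crystal3D`, second prover lane (poly-p2,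
gen 12).  Generalizes `rung_twinCaps` (one cap per facet; parent globally below the cap planes).  Data
(all grains given as polyhedral sets of finite volume — instantiate with `E ∩ slab`, `E ∩ slab ∩
localizer`, … via `poly_inter_slab` / `poly_inter_polytope`): a parent `P` with frame `A₀`; for each
facet `i < k` an axis `m i`, heights `t i 0 < … < t i n` and a STACK of lamellae `L i j ⊆
{t i j < ⟪x, m i⟫ < t i (j+1)}` with frames `B i j`, each co-axial with `A₀` about `m i`
(`Ax (m i) A₀ (B i j)`; parent lattice or its twin); the LOCALIZED parent clause `⟪x, m i⟫ < t i 0 ∨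
δ ≤ dist (x, colony i)` for `x ∈ P` (elsewhere the parent may rise above the base plane — plates on part
of a face); different colonies `δ`-separated.  Every wall is a coherent basal twin plane (budget 0).
Conclusion: `Fr ≥ 6·2^{1/3}(√2·Vol)^{2/3}` for the family `(P, L i j)` (flattened to `Fin (k·n+1)` by
`Fin.divNat`/`Fin.modNat`); `rung_twinColonies_texture` is the crux's `Tex`/`En` form (walls ≥ 0).
This is the planner's residual (P-R2) «thick colonies of different axes joined to a common parent
through free basal walls» (ROUTE §86(65) BH, §86(68) BK) for pairwise separated colonies, and (P-R3)
caps on PARTIAL facets.  Proof: `twinColonies_chimera_lower` + `volume_chimera_texture_le` as in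
`rung_basalLamellar` / `rung_twinCaps`.
WHAT THIS IS NOT: a registered stub; colonies touching each other, secondary twins about a second axis
inside a colony, charged walls are not here; the crux is not claimed.
-/

noncomputable section

open scoped BigOperators InnerProductSpace ENNReal Pointwise
open MeasureTheory Filter Set

namespace Summit.Ventures.Crystal3D.Cruxes.PolycrystalWulffBound.PolyDensity

open Summit.Ventures.Crystal3D.Theorems
open Summit.Ventures.Crystal3D.Cruxes.TextureLiminf.TexShadow (per polytope E3)
open Literature.MathematicalPhysics.StatisticalMechanics (fccStacking barlowStacking IsHaggSeq perimeter)

/-- **Rung `rung_twinColonies`** (uniform, multi-axis, lamellar colonies, localized parent clause, zero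
wall budget): see the module docstring. -/
theorem rung_twinColonies : let Λ : Set (EuclideanSpace ℝ (Fin 3)) := Literature.MathematicalPhysics.StatisticalMechanics.fccStacking 1 (Real.sqrt (2 / 3)); let Brl : (ℤ → ℤ) → Set (EuclideanSpace ℝ (Fin 3)) := Literature.MathematicalPhysics.StatisticalMechanics.barlowStacking 1 (Real.sqrt (2 / 3)); let Ax : EuclideanSpace ℝ (Fin 3) → (EuclideanSpace ℝ (Fin 3) ≃ₗᵢ[ℝ] EuclideanSpace ℝ (Fin 3)) → (EuclideanSpace ℝ (Fin 3) ≃ₗᵢ[ℝ] EuclideanSpace ℝ (Fin 3)) → Prop := fun m A B => ∃ (L : EuclideanSpace ℝ (Fin 3) ≃ₗᵢ[ℝ] EuclideanSpace ℝ (Fin 3)) (s₁ s₂ : EuclideanSpace ℝ (Fin 3)) (σ σ' : ℤ → ℤ), Literature.MathematicalPhysics.StatisticalMechanics.IsHaggSeq σ ∧ Literature.MathematicalPhysics.StatisticalMechanics.IsHaggSeq σ' ∧ L (EuclideanSpace.single (2 : Fin 3) (1 : ℝ)) = m ∧ A '' Λ ⊆ (fun q => L q + s₁) '' Brl σ ∧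 B '' Λ ⊆ (fun q => L q + s₂) '' Brl σ'; let Φ : EuclideanSpace ℝ (Fin 3) → ℝ := fun ν => Real.sqrt 2 / 4 * ∑ᶠ w ∈ {w ∈ Λ | ‖w‖ = 1}, |⟪w, ν⟫_ℝ|; let Per : Set (EuclideanSpace ℝ (Fin 3)) → Set (EuclideanSpace ℝ (Fin 3)) → ℝ := fun K S => (⨆ (ξ : EuclideanSpace ℝ (Fin 3) → EuclideanSpace ℝ (Fin 3)) (_ : ContDiff ℝ 1 ξ ∧ HasCompactSupport ξ ∧ ∀ z, ξ z ∈ K), ENNReal.ofReal (∫ z in S, Literature.MathematicalPhysics.StatisticalMechanics.fieldDivergence ξ z)).toReal; let ι : Set (EuclideanSpace ℝ (Fin 3)) → Set (EuclideanSpace ℝ (Fin 3)) → Set (EuclideanSpace ℝ (Fin 3)) → ℝ := fun K S₁ S₂ => (Per K S₁ + Per K S₂ - Per K (S₁ ∪ S₂)) / 2; let W : (EuclideanSpace ℝ (Fin 3) ≃ₗᵢ[ℝ] EuclideanSpace ℝ (Fin 3)) → Set (EuclideanSpace ℝ (Fin 3)) := fun A => {y | ∀ ν : EuclideanSpace ℝ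 (Fin 3), ⟪y, ν⟫_ℝ ≤ Φ (A.symm ν)}; let Vol : (n : ℕ) → (Fin n → Set (EuclideanSpace ℝ (Fin 3))) → ℝ := fun n G => (volume (⋃ f : Fin n, G f)).toReal; let Poly : Set (EuclideanSpace ℝ (Fin 3)) → Prop := fun S => ∃ (k : ℕ) (H : Fin k → Finset ((EuclideanSpace ℝ (Fin 3)) × ℝ)), S = ⋃ i, ⋂ p ∈ H i, {x | ⟪p.1, x⟫_ℝ < p.2}; let Fr : (n : ℕ) → (Fin n → Set (EuclideanSpace ℝ (Fin 3))) → (Fin n → (EuclideanSpace ℝ (Fin 3) ≃ₗᵢ[ℝ] EuclideanSpace ℝ (Fin 3))) → ℝ := fun n G A => ∑ f : Fin n, Per (W (A f)) (G f) - ∑ f, ∑ g, (if f = g then 0 else ι (W (A f)) (G f) (G g)); ∀ (k n : ℕ) (m : Fin k → EuclideanSpace ℝ (Fin 3)) (t : Fin k → Fin (n + 1) → ℝ), (∀ i, StrictMono (t i)) → ∀ (P : Set (EuclideanSpace ℝ (Fin 3))) (L : Fin k → Fin n → Set (EuclideanSpace ℝ (Fin 3))), Poly P → (∀ i j, Poly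 (L i j)) → volume P < ⊤ → (∀ i j, volume (L i j) < ⊤) → ∀ (A₀ : EuclideanSpace ℝ (Fin 3) ≃ₗᵢ[ℝ] EuclideanSpace ℝ (Fin 3)) (B : Fin k → Fin n → (EuclideanSpace ℝ (Fin 3) ≃ₗᵢ[ℝ] EuclideanSpace ℝ (Fin 3))), (∀ i, Ax (m i) A₀ A₀) → (∀ i j, Ax (m i) A₀ (B i j)) → (∀ i j, ∀ x ∈ L i j, t i j.castSucc < ⟪x, m i⟫_ℝ ∧ ⟪x, m i⟫_ℝ < t i j.succ) → ∀ (δ : ℝ), 0 < δ → (∀ x ∈ P, ∀ i, ⟪x, m i⟫_ℝ < t i 0 ∨ ∀ j, ∀ y ∈ L i j, δ ≤ dist x y) → (∀ i i', i ≠ i' → ∀ j j', ∀ x ∈ L i j, ∀ y ∈ L i' j', δ ≤ dist x y) → 6 * (2 : ℝ) ^ ((1 : ℝ) / 3) * (Real.sqrt 2 * Vol (k * n + 1) (Matrix.vecCons P (fun g : Fin (k * n) => L g.divNat g.modNat))) ^ ((2 : ℝ) / 3) ≤ Fr (k * n + 1) (Matrix.vecCons P (fun g : Fin (k * n) => L g.divNat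 g.modNat)) (Matrix.vecCons A₀ (fun g : Fin (k * n) => B g.divNat g.modNat)) := by
  intro Λ Brl Ax Φ Per ι W Vol Poly Fr k n m t ht P L hPpoly hLpoly hPv hLv A₀ B hA₀ hB hLt δ hδ hPt hsep
  classical
  set G : Fin (k * n + 1) → Set E3 := Matrix.vecCons P (fun g : Fin (k * n) => L g.divNat g.modNat)
    with hG
  set A : Fin (k * n + 1) → (E3 ≃ₗᵢ[ℝ] E3) :=
    Matrix.vecCons A₀ (fun g : Fin (k * n) => B g.divNat g.modNat) with hA
  show 6 * (2 : ℝ) ^ ((1 : ℝ) / 3) * (Real.sqrt 2 * (volume (⋃ f, G f)).toReal) ^ ((2 : ℝ) / 3) ≤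
    (∑ f, Per (W (A f)) (G f)) - ∑ f, ∑ g, (if f = g then 0 else ι (W (A f)) (G f) (G g))
  rw [← Finset.sum_sub_distrib]
  have hG0 : G 0 = P := by simp [hG]
  have hGs : ∀ g : Fin (k * n), G g.succ = L g.divNat g.modNat := fun g => by simp [hG]
  have hA0 : A 0 = A₀ := by simp [hA]
  have hAs : ∀ g : Fin (k * n), A g.succ = B g.divNat g.modNat := fun g => by simp [hA]
  have hdm : ∀ i j, (finProdFinEquiv (i, j) : Fin (k * n)).divNat = i ∧
      (finProdFinEquiv (i, j) : Fin (k * n)).modNat = j := by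
    intro i j
    have h := finProdFinEquiv.symm_apply_apply (i, j)
    rw [finProdFinEquiv_symm_apply] at h
    exact ⟨congrArg Prod.fst h, congrArg Prod.snd h⟩
  -- polyhedrality, finiteness, disjointness
  have hPolyG : ∀ f, ∃ (k' : ℕ) (H : Fin k' → Finset (E3 × ℝ)), G f = ⋃ i, polytope (H i) := by
    intro f
    induction f using Fin.cases with
    | zero => rw [hG0]; exact hPpoly
    | succ g => rw [hGs]; exact hLpoly _ _
  have hvolG : ∀ f, volume (G f) < ⊤ := by
    intro f
    induction f using Fin.cases with
    | zero => rw [hG0]; exact hPv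
    | succ g => rw [hGs]; exact hLv _ _
  have ht0 : ∀ i (jj : Fin (n + 1)), t i 0 ≤ t i jj := fun i jj => (ht i).monotone (Fin.zero_le _)
  have hPL : ∀ i j, Disjoint P (L i j) := by
    intro i j
    rw [Set.disjoint_left]
    intro x hxP hxL
    rcases hPt x hxP i with h | h
    · exact lt_irrefl _ (lt_of_lt_of_le (h.trans_le (ht0 i _)) (hLt i j x hxL).1.le)
    · have h' := h j x hxL
      rw [dist_self] at h'
      exact absurd h' (not_le.2 hδ)
  have hLL : ∀ i j j', j ≠ j' → Disjoint (L i j) (L i j') := fun i j j' hjj' =>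
    Set.disjoint_left.2 fun x hx hx' => hjj' (lamella_index_unique (ht i) (hLt i j x hx) (hLt i j' x hx'))
  have hLL' : ∀ i i', i ≠ i' → ∀ j j', Disjoint (L i j) (L i' j') := fun i i' hii' j j' =>
    Set.disjoint_left.2 fun x hx hx' => by
      have h := hsep i i' hii' j j' x hx x hx'
      rw [dist_self] at h
      exact absurd h (not_le.2 hδ)
  have hdisjG : ∀ f g, f ≠ g → Disjoint (G f) (G g) := by
    intro f g hfg
    induction f using Fin.cases with
    | zero =>
      induction g using Fin.cases with
      | zero => exact absurd rfl hfg
      | succ g' => rw [hG0, hGs]; exact hPL _ _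
    | succ f' =>
      induction g using Fin.cases with
      | zero => rw [hG0, hGs]; exact (hPL _ _).symm
      | succ g' =>
        rw [hGs, hGs]
        have hne : f' ≠ g' := fun h => hfg (by rw [h])
        by_cases hi : f'.divNat = g'.divNat
        · have hj : f'.modNat ≠ g'.modNat := by
            intro hj
            apply hne
            have h1 : finProdFinEquiv.symm f' = finProdFinEquiv.symm g' := by
              rw [finProdFinEquiv_symm_apply, finProdFinEquiv_symm_apply, hi, hj]
            exact finProdFinEquiv.symm.injective h1
          rw [hi]
          exact hLL _ _ _ hj
        · exact hLL' _ _ hi _ _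
  -- bodies
  have hWc : ∀ f, IsCompact (W (A f)) := fun f => isCompact_cruxWulffBody (A f)
  have hWv : ∀ f, Convex ℝ (W (A f)) := fun f => convex_cruxWulffBody (A f)
  have hW0 : ∀ f, (0 : E3) ∈ W (A f) := fun f => zero_mem_cruxWulffBody (A f)
  have hWs : ∀ f, -W (A f) = W (A f) := fun f => neg_cruxWulffBody_eq (A f)
  have hFr0 : 0 ≤ ∑ f, (Per (W (A f)) (G f) - ∑ g, (if f = g then 0 else ι (W (A f)) (G f) (G g))) := by
    have h := freeEnergy_ge_mul_perimeter G hPolyG hvolG hdisjG (fun f => W (A f)) hWc hWv hW0 hWs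
      (Real.sqrt_pos.2 (by norm_num : (0:ℝ) < 3)) (fun f => closedBall_subset_cruxWulffBody (A f))
    exact le_trans (mul_nonneg (Real.sqrt_nonneg 3) ENNReal.toReal_nonneg) h
  set V : ℝ := (volume (⋃ f, G f)).toReal with hV
  have hV0 : 0 ≤ V := ENNReal.toReal_nonneg
  set F : ℝ := ∑ f, (Per (W (A f)) (G f) - ∑ g, (if f = g then 0 else ι (W (A f)) (G f) (G g))) with hF
  -- `⋃ G f = P ∪ ⋃ L i j`; openness; finiteness
  have hUG : (⋃ f, G f) = P ∪ ⋃ i, ⋃ j, L i j := by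
    ext x
    simp only [mem_iUnion, mem_union]
    rw [Fin.exists_fin_succ, hG0]
    simp only [hGs]
    constructor
    · rintro (h | ⟨g, hg⟩)
      · exact Or.inl h
      · exact Or.inr ⟨_, _, hg⟩
    · rintro (h | ⟨i, j, h⟩)
      · exact Or.inl h
      · refine Or.inr ⟨finProdFinEquiv (i, j), ?_⟩
        rw [(hdm i j).1, (hdm i j).2]; exact h
  have hopen : ∀ S : Set E3, (∃ (k' : ℕ) (H : Fin k' → Finset (E3 × ℝ)), S = ⋃ i, polytope (H i)) →
      IsOpen S := by
    rintro S ⟨k', H, rfl⟩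
    exact isOpen_iUnion fun i => isOpen_biInter_finset fun q _ =>
      isOpen_lt (continuous_const.inner continuous_id) continuous_const
  have hPo : IsOpen P := hopen P hPpoly
  have hLo : ∀ i j, IsOpen (L i j) := fun i j => hopen _ (hLpoly i j)
  have hGo : ∀ f, IsOpen (G f) := fun f => hopen _ (hPolyG f)
  have hE'top : volume (⋃ f, G f) ≠ ⊤ := by
    refine (lt_of_le_of_lt (measure_iUnion_le _) ?_).ne
    rw [tsum_fintype]
    exact ENNReal.sum_lt_top.2 fun f _ => hvolG f
  by_cases hE'0 : volume (⋃ f, G f) = 0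
  · have hV00 : V = 0 := by rw [hV, hE'0, ENNReal.toReal_zero]
    rw [hV00, mul_zero, Real.zero_rpow (by norm_num), mul_zero]
    exact hFr0
  have hGbd : ∀ f, Bornology.IsBounded (G f) := by
    intro f
    obtain ⟨k', H, hGeq⟩ := hPolyG f
    rw [hGeq]
    refine Bornology.isBounded_iUnion.2 fun i => isBounded_hPolyhedron_of_volume_lt_top (H i) ?_
    exact lt_of_le_of_lt (measure_mono (by rw [hGeq]; exact subset_iUnion (fun i => polytope (H i)) i))
      (hvolG f)
  -- a common positive lower bound for `δ` and the lamella gaps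
  have hgap : ∃ γ : ℝ, 0 < γ ∧ γ ≤ δ ∧ ∀ i (j : Fin n), γ ≤ t i j.succ - t i j.castSucc := by
    by_cases hne : (Finset.univ : Finset (Fin k × Fin n)).Nonempty
    · set γ₀ : ℝ := Finset.univ.inf' hne (fun p : Fin k × Fin n => t p.1 p.2.succ - t p.1 p.2.castSucc)
      refine ⟨min δ γ₀, lt_min hδ ((Finset.lt_inf'_iff hne).2 fun p _ =>
        sub_pos.2 (ht p.1 (Fin.castSucc_lt_succ (i := p.2)))), min_le_left _ _, fun i j => ?_⟩
      exact (min_le_right _ _).trans (Finset.inf'_le _ (Finset.mem_univ (i, j)))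
    · exact ⟨δ, hδ, le_rfl, fun i j => absurd ⟨(i, j), Finset.mem_univ _⟩ hne⟩
  obtain ⟨γ, hγ0, hγδ, hγt⟩ := hgap
  -- the chimera neighbourhood of radius `r`
  have key : ∀ ε : ℝ, 0 < ε → 3 * (32 : ℝ) ^ ((3 : ℝ)⁻¹) * (V ^ ((3 : ℝ)⁻¹)) ^ 2 ≤ F + ε := by
    intro ε hε
    obtain ⟨r₀, hr₀, hup⟩ := volume_chimera_texture_le G hPolyG hvolG hdisjG (fun f => W (A f))
      hWc hWv hW0 hWs hε
    have h51 : 0 < 2 * (Real.sqrt 5 + 1) := by positivity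
    set r : ℝ := min (r₀ / 2) (γ / (2 * (Real.sqrt 5 + 1))) with hr
    have hr0 : 0 < r := lt_min (by positivity) (div_pos hγ0 h51)
    have hrr₀ : r < r₀ := lt_of_le_of_lt (min_le_left _ _) (by linarith)
    have hrγ : r * (2 * (Real.sqrt 5 + 1)) ≤ γ := by
      have h1 : r ≤ γ / (2 * (Real.sqrt 5 + 1)) := min_le_right _ _
      calc r * (2 * (Real.sqrt 5 + 1)) ≤ γ / (2 * (Real.sqrt 5 + 1)) * (2 * (Real.sqrt 5 + 1)) := by
            gcongr
        _ = γ := div_mul_cancel₀ γ h51.ne'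
    set Cr : Set E3 := ⋃ f, ⋃ x ∈ G f, x +ᵥ (r • W (A f)) with hCr
    have hCopen : IsOpen Cr := by
      have hCeq : Cr = ⋃ f, ⋃ w ∈ r • W (A f), (fun x => x + w) '' G f := by
        ext y
        simp only [hCr, mem_iUnion, Set.mem_vadd_set, vadd_eq_add, mem_image, exists_prop]
        constructor
        · rintro ⟨f, x, hx, w, hw, rfl⟩; exact ⟨f, w, hw, x, hx, rfl⟩
        · rintro ⟨f, w, hw, x, hx, rfl⟩; exact ⟨f, x, hx, w, hw, rfl⟩
      rw [hCeq]
      exact isOpen_iUnion fun f => isOpen_biUnion fun w _ => (isOpenMap_add_right w) _ (hGo f)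
    have hCfin : volume Cr ≠ ⊤ := by
      obtain ⟨R₁, hR₁⟩ := (Bornology.isBounded_iUnion.2 hGbd).subset_closedBall 0
      have hCsub : Cr ⊆ Metric.closedBall (0 : E3) (R₁ + r * Real.sqrt 5) := by
        intro y hy
        simp only [hCr, mem_iUnion, Set.mem_vadd_set, vadd_eq_add, exists_prop] at hy
        obtain ⟨f, x, hx, w, hw, rfl⟩ := hy
        obtain ⟨w', hw', rfl⟩ := Set.mem_smul_set.1 hw
        have hx' : ‖x‖ ≤ R₁ := mem_closedBall_zero_iff.1 (hR₁ (mem_iUnion.2 ⟨f, hx⟩))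
        have hw'' : ‖w'‖ ≤ Real.sqrt 5 :=
          mem_closedBall_zero_iff.1 (cruxWulffBody_subset_closedBall (A f) hw')
        rw [mem_closedBall_zero_iff]
        calc ‖x + r • w'‖ ≤ ‖x‖ + ‖r • w'‖ := norm_add_le _ _
          _ = ‖x‖ + r * ‖w'‖ := by rw [norm_smul, Real.norm_of_nonneg hr0.le]
          _ ≤ R₁ + r * Real.sqrt 5 := by gcongr
      exact (lt_of_le_of_lt (measure_mono hCsub) measure_closedBall_lt_top).ne
    -- lower bound (piecewise Brunn–Minkowski) and upper bound (Minkowski content)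
    have h0' : volume (P ∪ ⋃ i, ⋃ j, L i j) ≠ 0 := by rwa [← hUG]
    have htop' : volume (P ∪ ⋃ i, ⋃ j, L i j) ≠ ⊤ := by rwa [← hUG]
    have hselfB : ∀ i j, ∃ (L' : E3 ≃ₗᵢ[ℝ] E3) (s₁ s₂ : E3) (σ σ' : ℤ → ℤ), IsHaggSeq σ ∧ IsHaggSeq σ' ∧
        L' (EuclideanSpace.single (2 : Fin 3) (1 : ℝ)) = m i ∧
        B i j '' fccStacking 1 (Real.sqrt (2 / 3)) ⊆
          (fun q => L' q + s₁) '' barlowStacking 1 (Real.sqrt (2 / 3)) σ ∧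
        B i j '' fccStacking 1 (Real.sqrt (2 / 3)) ⊆
          (fun q => L' q + s₂) '' barlowStacking 1 (Real.sqrt (2 / 3)) σ' := by
      intro i j
      obtain ⟨L', -, s₂, -, σ', -, hσ', hLm, -, h2⟩ := hB i j
      exact ⟨L', s₂, s₂, σ', σ', hσ', hσ', hLm, h2, h2⟩
    have hlow := twinColonies_chimera_lower m t ht A₀ B hA₀ hselfB P L hPo hLo hLt hδ hPt hsep h0' htop'
      hr0 (hrγ.trans hγδ) (fun i j => (hrγ.trans (hγt i j))) (U := Cr)
      (fun x hx w hw => mem_iUnion.2 ⟨0, mem_iUnion₂.2 ⟨x, by rw [hG0]; exact hx,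
        Set.mem_vadd_set.2 ⟨r • w, Set.smul_mem_smul_set (by rw [hA0]; exact hw), rfl⟩⟩⟩)
      (fun i j x hx w hw => mem_iUnion.2 ⟨(finProdFinEquiv (i, j)).succ, mem_iUnion₂.2 ⟨x,
        by rw [hGs, (hdm i j).1, (hdm i j).2]; exact hx,
        Set.mem_vadd_set.2 ⟨r • w, Set.smul_mem_smul_set
          (by rw [hAs, (hdm i j).1, (hdm i j).2]; exact hw), rfl⟩⟩⟩)
    rw [← hUG] at hlow
    have hupC : (volume Cr).toReal ≤ V + r * (F + ε) := hup r hr0 hrr₀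
    set c : ℝ := (32 : ℝ) ^ ((3 : ℝ)⁻¹) with hc
    have hc0 : 0 ≤ c := by positivity
    have hexp : (((3 : ℕ) : ℝ)⁻¹) = (3 : ℝ)⁻¹ := by norm_num
    have h1 : V ^ ((3 : ℝ)⁻¹) + r * c ≤ (volume Cr).toReal ^ ((3 : ℝ)⁻¹) := by
      have h := ENNReal.toReal_mono (ENNReal.rpow_ne_top_of_nonneg (by positivity) hCfin) hlow
      rw [ENNReal.toReal_add (ENNReal.rpow_ne_top_of_nonneg (by positivity) hE'top)
          (ENNReal.mul_ne_top ENNReal.ofReal_ne_top (ENNReal.rpow_ne_top_of_nonneg (by positivity)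
            ENNReal.ofReal_ne_top)),
        ENNReal.toReal_mul, ENNReal.toReal_ofReal hr0.le, ← ENNReal.toReal_rpow, ← ENNReal.toReal_rpow,
        ← ENNReal.toReal_rpow, ENNReal.toReal_ofReal (by norm_num : (0:ℝ) ≤ 32), hexp] at h
      exact h
    set x : ℝ := V ^ ((3 : ℝ)⁻¹) with hx
    have hx0 : 0 ≤ x := by positivity
    have hx3 : x ^ 3 = V := by
      rw [hx, show ((3 : ℝ)⁻¹) = ((3 : ℕ) : ℝ)⁻¹ by norm_num]
      exact Real.rpow_inv_natCast_pow hV0 (by norm_num)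
    have hC3 : ((volume Cr).toReal ^ ((3 : ℝ)⁻¹)) ^ 3 = (volume Cr).toReal := by
      rw [show ((3 : ℝ)⁻¹) = ((3 : ℕ) : ℝ)⁻¹ by norm_num]
      exact Real.rpow_inv_natCast_pow ENNReal.toReal_nonneg (by norm_num)
    have h2 : (x + r * c) ^ 3 ≤ V + r * (F + ε) := by
      calc (x + r * c) ^ 3 ≤ ((volume Cr).toReal ^ ((3 : ℝ)⁻¹)) ^ 3 := by gcongr
        _ = (volume Cr).toReal := hC3
        _ ≤ V + r * (F + ε) := hupC
    have h3 : r * (3 * c * x ^ 2) ≤ r * (F + ε) := by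
      nlinarith [hx3, h2, hx0, hc0, hr0.le, mul_nonneg (mul_nonneg hr0.le hc0) (mul_nonneg hr0.le hc0),
        pow_nonneg (mul_nonneg hr0.le hc0) 3, mul_nonneg hx0 (mul_nonneg (mul_nonneg hr0.le hc0) (mul_nonneg hr0.le hc0))]
    have h4 : 3 * c * x ^ 2 ≤ F + ε := le_of_mul_le_mul_left h3 hr0
    linarith
  rw [wulff_constant_eq hV0]
  exact le_of_forall_pos_le_add key

/-- **Texture form of `rung_twinColonies`** (the crux's own `Tex`/`En`): for ANY wall data `(c, mm)`
admitted by `Tex` (only `0 ≤ c` is used: every wall term is nonnegative) the crux's energy of the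
parent-and-colonies family satisfies `6·2^{1/3}(√2·Vol)^{2/3} ≤ En`, no charge used. -/
theorem rung_twinColonies_texture : let Λ : Set (EuclideanSpace ℝ (Fin 3)) := Literature.MathematicalPhysics.StatisticalMechanics.fccStacking 1 (Real.sqrt (2 / 3)); let Brl : (ℤ → ℤ) → Set (EuclideanSpace ℝ (Fin 3)) := Literature.MathematicalPhysics.StatisticalMechanics.barlowStacking 1 (Real.sqrt (2 / 3)); let Ax : EuclideanSpace ℝ (Fin 3) → (EuclideanSpace ℝ (Fin 3) ≃ₗᵢ[ℝ] EuclideanSpace ℝ (Fin 3)) → (EuclideanSpace ℝ (Fin 3) ≃ₗᵢ[ℝ] EuclideanSpace ℝ (Fin 3)) → Prop := fun m A B => ∃ (L : EuclideanSpace ℝ (Fin 3) ≃ₗᵢ[ℝ] EuclideanSpace ℝ (Fin 3)) (s₁ s₂ : EuclideanSpace ℝ (Fin 3)) (σ σ' : ℤ → ℤ), Literature.MathematicalPhysics.StatisticalMechanics.IsHaggSeq σ ∧ Literature.MathematicalPhysics.StatisticalMechanics.IsHaggSeq σ' ∧ L (EuclideanSpace.single (2 : Fin 3) (1 : ℝ))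 = m ∧ A '' Λ ⊆ (fun q => L q + s₁) '' Brl σ ∧ B '' Λ ⊆ (fun q => L q + s₂) '' Brl σ'; let CoAx : (EuclideanSpace ℝ (Fin 3) ≃ₗᵢ[ℝ] EuclideanSpace ℝ (Fin 3)) → (EuclideanSpace ℝ (Fin 3) ≃ₗᵢ[ℝ] EuclideanSpace ℝ (Fin 3)) → Prop := fun A B => ∃ m, Ax m A B; let Φ : EuclideanSpace ℝ (Fin 3) → ℝ := fun ν => Real.sqrt 2 / 4 * ∑ᶠ w ∈ {w ∈ Λ | ‖w‖ = 1}, |⟪w, ν⟫_ℝ|; let Per : Set (EuclideanSpace ℝ (Fin 3)) → Set (EuclideanSpace ℝ (Fin 3)) → ℝ := fun K S => (⨆ (ξ : EuclideanSpace ℝ (Fin 3) → EuclideanSpace ℝ (Fin 3)) (_ : ContDiff ℝ 1 ξ ∧ HasCompactSupport ξ ∧ ∀ z, ξ z ∈ K), ENNReal.ofReal (∫ z in S, Literature.MathematicalPhysics.StatisticalMechanics.fieldDivergence ξ z)).toReal; let ι : Set (EuclideanSpace ℝ (Fin 3)) → Set (EuclideanSpace ℝ (Fin 3)) → Set (EuclideanSpace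 ℝ (Fin 3)) → ℝ := fun K S₁ S₂ => (Per K S₁ + Per K S₂ - Per K (S₁ ∪ S₂)) / 2; let W : (EuclideanSpace ℝ (Fin 3) ≃ₗᵢ[ℝ] EuclideanSpace ℝ (Fin 3)) → Set (EuclideanSpace ℝ (Fin 3)) := fun A => {y | ∀ ν : EuclideanSpace ℝ (Fin 3), ⟪y, ν⟫_ℝ ≤ Φ (A.symm ν)}; let Dsc : EuclideanSpace ℝ (Fin 3) → Set (EuclideanSpace ℝ (Fin 3)) := fun m => {y | ‖y‖ ≤ 1 ∧ ⟪y, m⟫_ℝ = 0}; let Tex : (n : ℕ) → (Fin n → Set (EuclideanSpace ℝ (Fin 3))) → (Fin n → (EuclideanSpace ℝ (Fin 3) ≃ₗᵢ[ℝ] EuclideanSpace ℝ (Fin 3))) → (Fin n → Fin n → ℝ) → (Fin n → Fin n → EuclideanSpace ℝ (Fin 3)) → Prop := fun n G A c m => (∀ f : Fin n, Literature.MathematicalPhysics.StatisticalMechanics.HasFinitePerimeter (G f) ∧ volume (G f) < ⊤) ∧ (∀ f g, f ≠ g → Disjoint (G f) (G g)) ∧ (∀ f g, f ≠ g → 0 ≤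 c f g) ∧ (∀ f g, f ≠ g → ¬ CoAx (A f) (A g) → m f g = 0 ∧ 1 ≤ c f g) ∧ (∀ f g, f ≠ g → CoAx (A f) (A g) → A f '' Λ ≠ A g '' Λ → Ax (m f g) (A f) (A g) ∧ 1 / 2 ≤ c f g); let En : (n : ℕ) → (Fin n → Set (EuclideanSpace ℝ (Fin 3))) → (Fin n → (EuclideanSpace ℝ (Fin 3) ≃ₗᵢ[ℝ] EuclideanSpace ℝ (Fin 3))) → (Fin n → Fin n → ℝ) → (Fin n → Fin n → EuclideanSpace ℝ (Fin 3)) → ℝ := fun n G A c m => ∑ f : Fin n, Per (W (A f)) (G f) - ∑ f, ∑ g, (if f = g then 0 else ι (W (A f)) (G f) (G g)) + ∑ f, ∑ g, (if f = g then 0 else c f g / 2 * ι (Dsc (m f g)) (G f) (G g)); let Vol : (n : ℕ) → (Fin n → Set (EuclideanSpace ℝ (Fin 3))) → ℝ := fun n G => (volume (⋃ f : Fin n, G f)).toReal; let Poly : Set (EuclideanSpace ℝ (Fin 3)) → Prop := fun S => ∃ (k : ℕ) (H : Fin k → Finset ((EuclideanSpace ℝ (Fin 3)) × ℝ)), S =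 ⋃ i, ⋂ p ∈ H i, {x | ⟪p.1, x⟫_ℝ < p.2}; ∀ (k n : ℕ) (m : Fin k → EuclideanSpace ℝ (Fin 3)) (t : Fin k → Fin (n + 1) → ℝ), (∀ i, StrictMono (t i)) → ∀ (P : Set (EuclideanSpace ℝ (Fin 3))) (L : Fin k → Fin n → Set (EuclideanSpace ℝ (Fin 3))), Poly P → (∀ i j, Poly (L i j)) → volume P < ⊤ → (∀ i j, volume (L i j) < ⊤) → ∀ (A₀ : EuclideanSpace ℝ (Fin 3) ≃ₗᵢ[ℝ] EuclideanSpace ℝ (Fin 3)) (B : Fin k → Fin n → (EuclideanSpace ℝ (Fin 3) ≃ₗᵢ[ℝ] EuclideanSpace ℝ (Fin 3))), (∀ i, Ax (m i) A₀ A₀) → (∀ i j, Ax (m i) A₀ (B i j)) → (∀ i j, ∀ x ∈ L i j, t i j.castSucc < ⟪x, m i⟫_ℝ ∧ ⟪x, m i⟫_ℝ < t i j.succ) → ∀ (δ : ℝ), 0 < δ → (∀ x ∈ P, ∀ i, ⟪x, m i⟫_ℝ < t i 0 ∨ ∀ j, ∀ y ∈ L i j, δ ≤ dist x y) → (∀ i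 i', i ≠ i' → ∀ j j', ∀ x ∈ L i j, ∀ y ∈ L i' j', δ ≤ dist x y) → ∀ (c : Fin (k * n + 1) → Fin (k * n + 1) → ℝ) (mm : Fin (k * n + 1) → Fin (k * n + 1) → EuclideanSpace ℝ (Fin 3)), Tex (k * n + 1) (Matrix.vecCons P (fun g : Fin (k * n) => L g.divNat g.modNat)) (Matrix.vecCons A₀ (fun g : Fin (k * n) => B g.divNat g.modNat)) c mm → 6 * (2 : ℝ) ^ ((1 : ℝ) / 3) * (Real.sqrt 2 * Vol (k * n + 1) (Matrix.vecCons P (fun g : Fin (k * n) => L g.divNat g.modNat))) ^ ((2 : ℝ) / 3) ≤ En (k * n + 1) (Matrix.vecCons P (fun g : Fin (k * n) => L g.divNat g.modNat)) (Matrix.vecCons A₀ (fun g : Fin (k * n) => B g.divNat g.modNat)) c mm := by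
  intro Λ Brl Ax CoAx Φ Per ι W Dsc Tex En Vol Poly k n m t ht P L hPpoly hLpoly hPv hLv A₀ B hA₀ hB hLt
    δ hδ hPt hsep c mm hTex
  classical
  obtain ⟨hfin, hdisjG, hc0, -, -⟩ := hTex
  set G : Fin (k * n + 1) → Set E3 := Matrix.vecCons P (fun g : Fin (k * n) => L g.divNat g.modNat)
    with hG
  set A : Fin (k * n + 1) → (E3 ≃ₗᵢ[ℝ] E3) :=
    Matrix.vecCons A₀ (fun g : Fin (k * n) => B g.divNat g.modNat) with hA
  have hFr := rung_twinColonies k n m t ht P L hPpoly hLpoly hPv hLv A₀ B hA₀ hB hLt δ hδ hPt hsep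
  have hvol : ∀ f, volume (G f) < ⊤ := fun f => (hfin f).2
  have hGpoly : ∀ f, ∃ (k' : ℕ) (H : Fin k' → Finset (E3 × ℝ)), G f = ⋃ i, polytope (H i) := by
    intro f
    induction f using Fin.cases with
    | zero => simp only [hG, Matrix.cons_val_zero]; exact hPpoly
    | succ g => simp only [hG, Matrix.cons_val_succ]; exact hLpoly _ _
  have hDc : ∀ v : E3, IsCompact (Dsc v) := fun v =>
    Metric.isCompact_of_isClosed_isBounded
      ((isClosed_le continuous_norm continuous_const).inter
        (isClosed_eq (continuous_id.inner continuous_const) continuous_const))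
      (Metric.isBounded_closedBall.subset (cruxDisc_subset_closedBall v))
  have hwall : 0 ≤ ∑ f, ∑ g, (if f = g then 0 else c f g / 2 * ι (Dsc (mm f g)) (G f) (G g)) := by
    refine Finset.sum_nonneg fun f _ => Finset.sum_nonneg fun g _ => ?_
    split_ifs with hfg
    · exact le_rfl
    · have h := iota_nonneg_of_poly G hGpoly hvol hdisjG (hDc (mm f g)) (convex_cruxDisc (mm f g))
        (zero_mem_cruxDisc (mm f g)) hfg
      have hι : 0 ≤ ι (Dsc (mm f g)) (G f) (G g) := by
        show 0 ≤ (per (Dsc (mm f g)) (G f) + per (Dsc (mm f g)) (G g) - per (Dsc (mm f g)) (G f ∪ G g)) / 2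
        exact div_nonneg h zero_le_two
      exact mul_nonneg (div_nonneg (hc0 f g hfg) zero_le_two) hι
  show 6 * (2 : ℝ) ^ ((1 : ℝ) / 3) * (Real.sqrt 2 * (volume (⋃ f, G f)).toReal) ^ ((2 : ℝ) / 3) ≤
    (∑ f, Per (W (A f)) (G f)) - (∑ f, ∑ g, (if f = g then 0 else ι (W (A f)) (G f) (G g))) +
      ∑ f, ∑ g, (if f = g then 0 else c f g / 2 * ι (Dsc (mm f g)) (G f) (G g))
  linarith [hFr, hwall]

end Summit.Ventures.Crystal3D.Cruxes.PolycrystalWulffBound.PolyDensity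

end
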